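import Summits.ResolutionOfSingularities.ResolutionOfSingularities.Theorems.WildConesCampaignW46ThreefoldsCharTwoRegimeStatement
import Summits.ResolutionOfSingularities.ResolutionOfSingularities.Theorems.WildConesCampaignW46ThreefoldsCharTwoResolution
import Summits.ResolutionOfSingularities.ResolutionOfSingularities.Theorems.WildConesCampaignW46ThreefoldsCharTwoNearPoint
import Summits.ResolutionOfSingularities.ResolutionOfSingularities.Theorems.WildConesCampaignW46ThreefoldsCharTwoSingularBranch
import Summits.ResolutionOfSingularities.ResolutionOfSingularities.Theorems.WildConesCampaignW46ThreefoldsCharTwoFermatExit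
import Summits.ResolutionOfSingularities.ResolutionOfSingularities.Theorems.WildConesCampaignW46HypersurfacesCharTwoFivefoldNonClosure
import Summits.ResolutionOfSingularities.ResolutionOfSingularities.Theorems.WildConesCampaignW46HypersurfacesCharTwoFourfoldNonClosure

/-!
# [OURS · L1 W4.6, rung (ii) at p = 2] PROOFS BY NAME of the hyperbolic-splitting-regime statement predicates
# (`Theorems/WildConesCampaignW46ThreefoldsCharTwoRegimeStatement.lean`) at the instance `p = 2`

Cell res-hironaka (LADDER-RESOLUTION rung L, D-0089), slot W4.6, seat res-L1-s46-pv-4 (gen 2); host route `WildCones`,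
crux `ClassicalRegimes` (stmt-ResolutionOfSingularities-16884). Each theorem below is literally `<Predicate> 2`, closed by
the seat's theorems in `Theorems/WildConesCampaignW46ThreefoldsCharTwo{SplittingRegime,Resolution,NearPoint}.lean`
(p479260, p479500, p479531), so that a rank-9 item registered with signature `<Predicate> 2` closes `--by` the name here.
Everything is OURS; NOTHING is a statement of H. Hironaka's manuscript [Hironaka2017]; no FACT-LIST premise; axioms
standard. AI review is weaker than expert review.
-/

noncomputable section

set_option linter.dupNamespace false -- mandated namespace of this single-conjunct summit

namespace Summit.ResolutionOfSingularities.ResolutionOfSingularities.Theorems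

/-- [OURS · L1 W4.6 rung (ii) at `p = 2`; NOT a statement of the manuscript] `CampaignW46ThreefoldsSplittingClosed 2`:
the hyperbolic-splitting regime of threefold double points is closed under the point-blow-up dynamics, with the exact
drop, over every field of characteristic `2` — by `CampaignW46.ThreefoldsCharTwo.threefold_regime_step`. [folklore] -/
theorem campaignW46ThreefoldsSplittingClosed_two : CampaignW46ThreefoldsSplittingClosed 2 :=
  fun _ _ _ c i τ hM hO hI hM' => CampaignW46.ThreefoldsCharTwo.threefold_regime_step c i τ hM hO hI hM'

/-- [OURS · L1 W4.6 rung (ii) at `p = 2`; NOT a statement of the manuscript] `CampaignW46ThreefoldsForcedDichotomy 2`: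
for an isolated double state with a double successor, the successor is isolated iff the state is order-2 cleaned —
by `CampaignW46.ThreefoldsCharTwo.threefold_isol_step_iff_ordP`. [folklore] -/
theorem campaignW46ThreefoldsForcedDichotomy_two : CampaignW46ThreefoldsForcedDichotomy 2 :=
  fun _ _ _ c i τ hM hI hM' => CampaignW46.ThreefoldsCharTwo.threefold_isol_step_iff_ordP c i τ hM hI hM'

/-- [OURS · L1 W4.6 rung (ii) at `p = 2`; NOT a statement of the manuscript] `CampaignW46ThreefoldsSplittingResolves 2`:
from an order-2-cleaned isolated double point every word reaches a smooth point within `μ/2` blow-ups through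
order-2-cleaned isolated double points only — by `CampaignW46.ThreefoldsCharTwo.threefold_smooth_le_half`. [folklore] -/
theorem campaignW46ThreefoldsSplittingResolves_two : CampaignW46ThreefoldsSplittingResolves 2 :=
  fun _ _ _ c₀ i t hO hI => CampaignW46.ThreefoldsCharTwo.threefold_smooth_le_half c₀ i t hO hI

/-- [OURS · L1 W4.6 rung (ii) at `p = 2`; NOT a statement of the manuscript] `CampaignW46ThreefoldsNearPointUnique 2`:
at most one infinitely-near double point per chart — by `CampaignW46.ThreefoldsCharTwo.threefold_nearPoint_unique`.
[folklore] -/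
theorem campaignW46ThreefoldsNearPointUnique_two : CampaignW46ThreefoldsNearPointUnique 2 :=
  fun _ _ _ c i τ τ' hM hO h h' => CampaignW46.ThreefoldsCharTwo.threefold_nearPoint_unique c i τ τ' hM hO h h'

/-- [OURS · L1 W4.6 rung (ii) at `p = 2`; NOT a statement of the manuscript] `CampaignW46ThreefoldsMilnorEven 2`: the
Milnor number of an order-2-cleaned isolated threefold double point is even — by
`CampaignW46.ThreefoldsCharTwo.threefold_mu_even`. [folklore] -/
theorem campaignW46ThreefoldsMilnorEven_two : CampaignW46ThreefoldsMilnorEven 2 :=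
  fun _ _ _ c hM hO hI => CampaignW46.ThreefoldsCharTwo.threefold_mu_even (c := c) hM hO hI

/-- [OURS · L1 W4.6 rung (ii) at `p = 2`; NOT a statement of the manuscript] `CampaignW46ThreefoldsNearPointExists 2`:
an infinitely-near double point exists iff `μ ≥ 4` — by
`CampaignW46.ThreefoldsCharTwo.threefold_exists_double_successor_iff_four_le_mu` (p481532). Appended 2026-08-27.
[folklore] -/
theorem campaignW46ThreefoldsNearPointExists_two : CampaignW46ThreefoldsNearPointExists 2 :=
  fun _ _ _ c hM hO hI => CampaignW46.ThreefoldsCharTwo.threefold_exists_double_successor_iff_four_le_mu c hM hO hI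

/-- [OURS · L1 W4.6 rung (ii) at `p = 2`; NOT a statement of the manuscript] `CampaignW46ThreefoldsSingularBranch 2`:
the singular branch — exactly `μ/2` double points, then a smooth point — by
`CampaignW46.ThreefoldsCharTwo.threefold_singularBranch_exact` (p481799). Appended 2026-08-27. [folklore] -/
theorem campaignW46ThreefoldsSingularBranch_two : CampaignW46ThreefoldsSingularBranch 2 :=
  fun _ _ _ c₀ hM hO hI => CampaignW46.ThreefoldsCharTwo.threefold_singularBranch_exact c₀ hM hO hI

/-- [OURS · L1 W4.6 rung (ii) at `p = 2`, scope marker; NOT a statement of the manuscript]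
`CampaignW46ThreefoldsSidewaysExit 2` — by `CampaignW46.ThreefoldsCharTwo.threefold_exists_sidewaysExit` (p483423,
the Fermat cubic). Appended 2026-08-27 (rev 3). [folklore] -/
theorem campaignW46ThreefoldsSidewaysExit_two : CampaignW46ThreefoldsSidewaysExit 2 :=
  fun κ _ _ => CampaignW46.ThreefoldsCharTwo.threefold_exists_sidewaysExit κ

/-- [OURS · L1 W4.6 rung (ii) at `p = 2`, scope marker; NOT a statement of the manuscript]
`CampaignW46FivefoldsSplittingNotClosed 2` — by `CampaignW46.ThreefoldsCharTwo.fivefold_splittingRegime_not_closed`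
(p484275). Appended 2026-08-27 (rev 3). [folklore] -/
theorem campaignW46FivefoldsSplittingNotClosed_two : CampaignW46FivefoldsSplittingNotClosed 2 :=
  fun κ _ _ => CampaignW46.ThreefoldsCharTwo.fivefold_splittingRegime_not_closed κ

/-- [OURS · L1 W4.6 rung (ii) at `p = 2`, scope marker; NOT a statement of the manuscript]
`CampaignW46FourfoldsSplittingNotClosed 2` — by `CampaignW46.ThreefoldsCharTwo.fourfold_splittingRegime_not_closed`.
Appended 2026-08-27 (rev 4). [folklore] -/
theorem campaignW46FourfoldsSplittingNotClosed_two : CampaignW46FourfoldsSplittingNotClosed 2 :=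
  fun κ _ _ => CampaignW46.ThreefoldsCharTwo.fourfold_splittingRegime_not_closed κ

end Summit.ResolutionOfSingularities.ResolutionOfSingularities.Theorems

end
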